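import Summits.Ventures.PercRepro.Night2LocalD3ThreeOneB

/-!
# PercRepro — the cell `(a, k) = (3, 1)` at `|E ∖ G| = 3`, `q = 4`: **`load2_le_cap2_three_one`** (night-2, gen 13)

The assembly of `Night2LocalD3ThreeOneA/B.lean`: at a far set `S` with three coloops when `M|G` has one coloop, `load₂(S) ≤ cap₂(S)`.
Two fat candidates kill both layer-1 preimages of `S` (`cap₂ ≥ 7/10 ≥ 0.39`); otherwise at most one candidate is fat and the
evaluation at the type bounds is `≤ 0.2035 ≤ 0.22 ≤ cap₂`.
-/

open scoped Matroid

namespace PercRepro.Shadow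

open Finset PerFlat ThmH

variable {α : Type*} [DecidableEq α] {M : Matroid α} [M.Finite]

section ThreeOneC

variable {G S : Finset α}

open scoped Classical in
/-- **THE CELL `(a, k) = (3, 1)` AT `|E ∖ G| = 3`, `q = 4`**: every far set with three coloops satisfies `load₂(S) ≤ cap₂(S)`
when `M|G` has one coloop. -/
theorem load2_le_cap2_three_one (hs : ∀ e ∈ gr M, ∀ f ∈ gr M, e ≠ f → rkN M {e, f} = 2)
    (hG : G ∈ flatsQ M (4 + 1)) (hd : (gr M \ G).card = 3) (hk : kColoops M G = 1)
    (hS : S ∈ shadowAt M (4 + 2) 4 (Uq M (4 + 2) 4) G) (ha : (coloops M S).card = 3) :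
    load2 M 4 G S ≤ cap2 M 4 G S := by
  set K := G.filter (fun y => y ∉ clF M (G.erase y)) with hKdef
  obtain ⟨x₁, x₂, hne, hx₁K, hx₂K, hcol⟩ := exists_coloops_eq_insert_insert hS hk ha
  have hSG : S ⊆ G := subset_of_mem_shadowAt hS
  have hGg : G ⊆ gr M := (mem_flatsQ.1 hG).1
  have hcap0 : ∀ S', 0 ≤ capS M 4 G S' := capS_nonneg' hG (by omega)
  have hx₁c : x₁ ∈ coloops M S := by rw [hcol]; exact Finset.mem_insert_self _ _
  have hx₂c : x₂ ∈ coloops M S := by rw [hcol]; exact Finset.mem_insert_of_mem (Finset.mem_insert_self _ _)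
  have hx₁S : x₁ ∈ S := coloops_subset_self S hx₁c
  have hx₂S : x₂ ∈ S := coloops_subset_self S hx₂c
  -- the preimage mass of `S` and the capacity
  set ρ₁ := (if S.erase x₁ ∈ membersIn M (Uq M (4 + 2) 4) G then req M 4 (S.erase x₁) else 0) with hρ₁def
  set ρ₂ := (if S.erase x₂ ∈ membersIn M (Uq M (4 + 2) 4) G then req M 4 (S.erase x₂) else 0) with hρ₂def
  have hreq₁ : req M 4 (S.erase x₁) ≤ 6 / 25 := by
    have := req_le_of_le_card hG hd (clF_subset_of_subset_flatsQ hG ((Finset.erase_subset x₁ S).trans hSG))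
      (two_le_card_sdiff_clF_erase hS hx₁K hx₁c)
    norm_num at this; exact this
  have hreq₂ : req M 4 (S.erase x₂) ≤ 6 / 25 := by
    have := req_le_of_le_card hG hd (clF_subset_of_subset_flatsQ hG ((Finset.erase_subset x₂ S).trans hSG))
      (two_le_card_sdiff_clF_erase hS hx₂K hx₂c)
    norm_num at this; exact this
  have hρ₁le : ρ₁ ≤ req M 4 (S.erase x₁) := by rw [hρ₁def]; split_ifs; exact le_refl _; exact req_nonneg 4 _
  have hρ₂le : ρ₂ ≤ req M 4 (S.erase x₂) := by rw [hρ₂def]; split_ifs; exact le_refl _; exact req_nonneg 4 _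
  have hcap2 : 7 / 10 - (ρ₁ + ρ₂) ≤ cap2 M 4 G S := by
    have h1 := cap2_ge_capS_sub_L1 (M := M) (q := 4) (G := G) (S := S) (hcap0 S)
    have h2 := L1_le_req_erase_two hG hd hS hne hx₁K hx₂K hcol
    have h3 := seven_tenths_le_capS hd hk hSG
    linarith
  set r' := req M 4 (S.erase x₁) + req M 4 (S.erase x₂) with hr'def
  have hr' : r' ≤ 12 / 25 := by rw [hr'def]; linarith
  have hr'0 : 0 ≤ r' := by rw [hr'def]; linarith [req_nonneg (M := M) 4 (S.erase x₁), req_nonneg (M := M) 4 (S.erase x₂)]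
  by_cases hex : ex2 M 4 G S = ∅
  · rw [load2_eq_zero_of_ex2_eq_empty hex]
    exact cap2_nonneg (hcap0 S)
  obtain ⟨B₀, hB₀⟩ := Finset.nonempty_iff_ne_empty.2 hex
  have hS6 : S.card = 6 := card_eq_six_of_three hs hG hS ha hB₀
  have hT : (nonColoops M S).card = 3 := by
    have := Finset.card_sdiff_add_card_eq_card (coloops_subset_self (M := M) S)
    unfold nonColoops; omega
  obtain ⟨w₁, w₂, w₃, h12, h13, h23, hT3⟩ := Finset.card_eq_three.1 hT
  have hw₁ : w₁ ∈ nonColoops M S := by rw [hT3]; exact Finset.mem_insert_self _ _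
  have hw₂ : w₂ ∈ nonColoops M S := by rw [hT3]; exact Finset.mem_insert_of_mem (Finset.mem_insert_self _ _)
  have hw₃ : w₃ ∈ nonColoops M S := by
    rw [hT3]; exact Finset.mem_insert_of_mem (Finset.mem_insert_of_mem (Finset.mem_singleton_self _))
  have hT3' : nonColoops M S = {w₂, w₁, w₃} := by rw [hT3, Finset.insert_comm w₁ w₂]
  have hT3'' : nonColoops M S = {w₃, w₁, w₂} := by rw [hT3, Finset.pair_comm w₂ w₃, Finset.insert_comm w₁ w₃]
  -- the quantities
  set r₁ := (if insert w₁ (coloops M S) ∈ membersIn M (Uq M (4 + 2) 4) G then req M 4 (insert w₁ (coloops M S)) else 0)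
    with hr₁def
  set r₂ := (if insert w₂ (coloops M S) ∈ membersIn M (Uq M (4 + 2) 4) G then req M 4 (insert w₂ (coloops M S)) else 0)
    with hr₂def
  set r₃ := (if insert w₃ (coloops M S) ∈ membersIn M (Uq M (4 + 2) 4) G then req M 4 (insert w₃ (coloops M S)) else 0)
    with hr₃def
  set a₁ := (if insert w₁ (coloops M S) ∈ ex2 M 4 G S then
    req M 4 (insert w₁ (coloops M S)) / (((G \ clF M (insert w₁ (coloops M S))).card : ℚ) - 1) else 0) with ha₁def
  set a₂ := (if insert w₂ (coloops M S) ∈ ex2 M 4 G S then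
    req M 4 (insert w₂ (coloops M S)) / (((G \ clF M (insert w₂ (coloops M S))).card : ℚ) - 1) else 0) with ha₂def
  set a₃ := (if insert w₃ (coloops M S) ∈ ex2 M 4 G S then
    req M 4 (insert w₃ (coloops M S)) / (((G \ clF M (insert w₃ (coloops M S))).card : ℚ) - 1) else 0) with ha₃def
  have hr₁' : insert w₁ (coloops M S) ∈ membersIn M (Uq M (4 + 2) 4) G → req M 4 (insert w₁ (coloops M S)) ≤ r₁ :=
    fun h => by rw [hr₁def, if_pos h]
  have hr₂' : insert w₂ (coloops M S) ∈ membersIn M (Uq M (4 + 2) 4) G → req M 4 (insert w₂ (coloops M S)) ≤ r₂ :=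
    fun h => by rw [hr₂def, if_pos h]
  have hr₃' : insert w₃ (coloops M S) ∈ membersIn M (Uq M (4 + 2) 4) G → req M 4 (insert w₃ (coloops M S)) ≤ r₃ :=
    fun h => by rw [hr₃def, if_pos h]
  have hr₁0 : 0 ≤ r₁ := by rw [hr₁def]; split_ifs; exact req_nonneg 4 _; exact le_refl _
  have hr₂0 : 0 ≤ r₂ := by rw [hr₂def]; split_ifs; exact req_nonneg 4 _; exact le_refl _
  have hr₃0 : 0 ≤ r₃ := by rw [hr₃def]; split_ifs; exact req_nonneg 4 _; exact le_refl _
  have ha₁0 : 0 ≤ a₁ := cand_share_nonneg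
  have ha₂0 : 0 ≤ a₂ := cand_share_nonneg
  have ha₃0 : 0 ≤ a₃ := cand_share_nonneg
  -- the covering sets of a candidate in `ex2` are shadow sets; the layer-1 requests there
  have hcovS : ∀ w u u', nonColoops M S = {w, u, u'} → w ≠ u → w ≠ u' → u ≠ u' →
      insert w (coloops M S) ∈ ex2 M 4 G S → S.erase u' ∈ shadowAt M (4 + 2) 4 (Uq M (4 + 2) 4) G := by
    intro w u u' hT' hwu hwu' huu' hB
    obtain ⟨hBm, -, -, hsub, -⟩ := mem_ex2_unpack hB
    have hu : u ∈ S \ insert w (coloops M S) := by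
      have huT : u ∈ nonColoops M S := by rw [hT']; exact Finset.mem_insert_of_mem (Finset.mem_insert_self _ _)
      refine Finset.mem_sdiff.2 ⟨(mem_nonColoops.1 huT).1, ?_⟩
      rw [Finset.mem_insert]
      rintro (h | h)
      · exact hwu h.symm
      · exact (mem_nonColoops.1 huT).2 h
    have hT'' : nonColoops M S = {u', u, w} := by
      rw [hT', Finset.pair_comm u u', Finset.insert_comm w u', Finset.pair_comm w u]
    have heq : S.erase u' = insert u (insert w (coloops M S)) := by
      have hu'T : u' ∈ nonColoops M S := by
        rw [hT']; exact Finset.mem_insert_of_mem (Finset.mem_insert_of_mem (Finset.mem_singleton_self _))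
      rw [← erase_erase_eq_insert hT'' huu'.symm hwu'.symm hwu.symm, Finset.insert_erase]
      rw [Finset.mem_erase]
      exact ⟨huu', (mem_nonColoops.1 (by rw [hT']; exact Finset.mem_insert_of_mem (Finset.mem_insert_self _ _) : u ∈ nonColoops M S)).1⟩
    rw [heq]
    exact insert_mem_shadowAt (Finset.Subset.refl _) hG hBm (hsub hu)
  -- the load through the three candidates, with the loss fraction at `7/10`
  set lam : ℚ → ℚ := fun L => if L ≤ 7 / 10 then (0 : ℚ) else (L - 7 / 10) / L with hlamdef
  have ht₁ : (if insert w₁ (coloops M S) ∈ ex2 M 4 G S then w2 M 4 G (insert w₁ (coloops M S)) S else 0) ≤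
      a₁ * (lam (r' + r₁ + r₃) + lam (r' + r₁ + r₂)) := by
    by_cases h : insert w₁ (coloops M S) ∈ ex2 M 4 G S
    · rw [ha₁def, if_pos h, if_pos h]
      have hS₂ : S.erase w₂ ∈ shadowAt M (4 + 2) 4 (Uq M (4 + 2) 4) G := hcovS w₁ w₃ w₂ (by rw [hT3, Finset.pair_comm]) h13 h12 h23.symm h
      have hS₃ : S.erase w₃ ∈ shadowAt M (4 + 2) 4 (Uq M (4 + 2) 4) G := hcovS w₁ w₂ w₃ hT3 h12 h13 h23 h
      have hL₂ : L1 M 4 G (S.erase w₂) ≤ r' + r₁ + r₃ :=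
        L1_erase_le_four hG hd hS hne hx₁K hx₂K hcol hT3' h12.symm h23 h13 hS₂ hr₁' hr₃' hr₁0 hr₃0
      have hL₃ : L1 M 4 G (S.erase w₃) ≤ r' + r₁ + r₂ :=
        L1_erase_le_four hG hd hS hne hx₁K hx₂K hcol hT3'' h13.symm h23.symm h12 hS₃ hr₁' hr₂' hr₁0 hr₂0
      exact w2_cand_le_one hd hk hS hT3 h12 h13 h23 h hL₂ hL₃
    · rw [ha₁def, if_neg h, if_neg h, zero_mul]
  have ht₂ : (if insert w₂ (coloops M S) ∈ ex2 M 4 G S then w2 M 4 G (insert w₂ (coloops M S)) S else 0) ≤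
      a₂ * (lam (r' + r₂ + r₃) + lam (r' + r₁ + r₂)) := by
    by_cases h : insert w₂ (coloops M S) ∈ ex2 M 4 G S
    · rw [ha₂def, if_pos h, if_pos h]
      have hS₁ : S.erase w₁ ∈ shadowAt M (4 + 2) 4 (Uq M (4 + 2) 4) G :=
        hcovS w₂ w₃ w₁ (by rw [hT3', Finset.pair_comm]) h23 h12.symm h13.symm h
      have hS₃ : S.erase w₃ ∈ shadowAt M (4 + 2) 4 (Uq M (4 + 2) 4) G := hcovS w₂ w₁ w₃ hT3' h12.symm h23 h13 h
      have hL₁ : L1 M 4 G (S.erase w₁) ≤ r' + r₂ + r₃ :=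
        L1_erase_le_four hG hd hS hne hx₁K hx₂K hcol hT3 h12 h13 h23 hS₁ hr₂' hr₃' hr₂0 hr₃0
      have hL₃ : L1 M 4 G (S.erase w₃) ≤ r' + r₁ + r₂ :=
        L1_erase_le_four hG hd hS hne hx₁K hx₂K hcol hT3'' h13.symm h23.symm h12 hS₃ hr₁' hr₂' hr₁0 hr₂0
      exact w2_cand_le_one hd hk hS hT3' h12.symm h23 h13 h hL₁ hL₃
    · rw [ha₂def, if_neg h, if_neg h, zero_mul]
  have ht₃ : (if insert w₃ (coloops M S) ∈ ex2 M 4 G S then w2 M 4 G (insert w₃ (coloops M S)) S else 0) ≤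
      a₃ * (lam (r' + r₂ + r₃) + lam (r' + r₁ + r₃)) := by
    by_cases h : insert w₃ (coloops M S) ∈ ex2 M 4 G S
    · rw [ha₃def, if_pos h, if_pos h]
      have hS₁ : S.erase w₁ ∈ shadowAt M (4 + 2) 4 (Uq M (4 + 2) 4) G :=
        hcovS w₃ w₂ w₁ (by rw [hT3'', Finset.pair_comm]) h23.symm h13.symm h12.symm h
      have hS₂ : S.erase w₂ ∈ shadowAt M (4 + 2) 4 (Uq M (4 + 2) 4) G := hcovS w₃ w₁ w₂ hT3'' h13.symm h23.symm h12 h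
      have hL₁ : L1 M 4 G (S.erase w₁) ≤ r' + r₂ + r₃ :=
        L1_erase_le_four hG hd hS hne hx₁K hx₂K hcol hT3 h12 h13 h23 hS₁ hr₂' hr₃' hr₂0 hr₃0
      have hL₂ : L1 M 4 G (S.erase w₂) ≤ r' + r₁ + r₃ :=
        L1_erase_le_four hG hd hS hne hx₁K hx₂K hcol hT3' h12.symm h23 h13 hS₂ hr₁' hr₃' hr₁0 hr₃0
      exact w2_cand_le_one hd hk hS hT3'' h13.symm h23.symm h12 h hL₁ hL₂
    · rw [ha₃def, if_neg h, if_neg h, zero_mul]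
  have hload := load2_le_three_cand hG hd hs hS ha hT3
  -- the type bounds
  have hty₁ := cand_types hG hd hS hS6 hT hw₁
  have hty₂ := cand_types hG hd hS hS6 hT hw₂
  have hty₃ := cand_types hG hd hS hS6 hT hw₃
  have hlam0 : ∀ L, 0 ≤ lam L := lossFracC_nonneg (by norm_num)
  have hlam : ∀ {L L' : ℚ}, L ≤ L' → lam L ≤ lam L' := fun h => lossFracC_mono (by norm_num) h
  -- the main inequality
  have hmain : a₁ * (lam (r' + r₁ + r₃) + lam (r' + r₁ + r₂)) + a₂ * (lam (r' + r₂ + r₃) + lam (r' + r₁ + r₂)) +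
      a₃ * (lam (r' + r₂ + r₃) + lam (r' + r₁ + r₃)) ≤ 7 / 10 - (ρ₁ + ρ₂) := by
    -- two fat candidates kill the preimages of `S`
    have htwo : ∀ {i j : α}, i ∈ nonColoops M S → j ∈ nonColoops M S → i ≠ j →
        G \ S ⊆ clF M (insert i (coloops M S)) → G \ S ⊆ clF M (insert j (coloops M S)) → ρ₁ + ρ₂ = 0 := by
      intro i j hi hj hij hfi hfj
      have h1 := not_erase_mem_Uq_of_two_fat hG hd hS hS6 hT hx₁K hx₂K hcol hi hj hij hfi hfj (Or.inl rfl)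
      have h2 := not_erase_mem_Uq_of_two_fat hG hd hS hS6 hT hx₁K hx₂K hcol hi hj hij hfi hfj (Or.inr rfl)
      rw [hρ₁def, hρ₂def, if_neg (fun h => h1 (mem_membersIn.1 h).1), if_neg (fun h => h2 (mem_membersIn.1 h).1), add_zero]
    have hρ0 : 0 ≤ ρ₁ + ρ₂ := by
      have : 0 ≤ ρ₁ := by rw [hρ₁def]; split_ifs; exact req_nonneg 4 _; exact le_refl _
      have : 0 ≤ ρ₂ := by rw [hρ₂def]; split_ifs; exact req_nonneg 4 _; exact le_refl _
      linarith
    have hρle : ρ₁ + ρ₂ ≤ 12 / 25 := by linarith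
    by_cases hf₁ : G \ S ⊆ clF M (insert w₁ (coloops M S)) <;>
    by_cases hf₂ : G \ S ⊆ clF M (insert w₂ (coloops M S)) <;>
    by_cases hf₃ : G \ S ⊆ clF M (insert w₃ (coloops M S))
    · rw [htwo hw₁ hw₂ h12 hf₁ hf₂]
      exact cand_arith_gen lam hlam0 hlam (7 / 10) 0 0 r' r₁ r₂ r₃ a₁ a₂ a₃ _ _ _ (12 / 25) (6 / 25) (6 / 25) (6 / 25)
        (6 / 25) (6 / 25) (6 / 25) ha₁0 ha₂0 ha₃0 (le_refl _) (le_refl _) (le_refl _) (le_refl _) hr' hty₁.1.1 hty₂.1.1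
        hty₃.1.1 hty₁.1.2 hty₂.1.2 hty₃.1.2 (by rw [hlamdef]; norm_num)
    · rw [htwo hw₁ hw₂ h12 hf₁ hf₂]
      exact cand_arith_gen lam hlam0 hlam (7 / 10) 0 0 r' r₁ r₂ r₃ a₁ a₂ a₃ _ _ _ (12 / 25) (6 / 25) (6 / 25) (6 / 25)
        (6 / 25) (6 / 25) (6 / 25) ha₁0 ha₂0 ha₃0 (le_refl _) (le_refl _) (le_refl _) (le_refl _) hr' hty₁.1.1 hty₂.1.1
        hty₃.1.1 hty₁.1.2 hty₂.1.2 hty₃.1.2 (by rw [hlamdef]; norm_num)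
    · rw [htwo hw₁ hw₃ h13 hf₁ hf₃]
      exact cand_arith_gen lam hlam0 hlam (7 / 10) 0 0 r' r₁ r₂ r₃ a₁ a₂ a₃ _ _ _ (12 / 25) (6 / 25) (6 / 25) (6 / 25)
        (6 / 25) (6 / 25) (6 / 25) ha₁0 ha₂0 ha₃0 (le_refl _) (le_refl _) (le_refl _) (le_refl _) hr' hty₁.1.1 hty₂.1.1
        hty₃.1.1 hty₁.1.2 hty₂.1.2 hty₃.1.2 (by rw [hlamdef]; norm_num)
    · -- only `w₁` fat
      have h2 := hty₂.2 (three_le_card_sdiff_clF_cand_of_not_fat hG hS hS6 hT hw₂ hf₂)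
      have h3 := hty₃.2 (three_le_card_sdiff_clF_cand_of_not_fat hG hS hS6 hT hw₃ hf₃)
      exact cand_arith_gen lam hlam0 hlam (7 / 10) (ρ₁ + ρ₂) (12 / 25) r' r₁ r₂ r₃ a₁ a₂ a₃ _ _ _ (12 / 25) (6 / 25) (1 / 5)
        (1 / 5) (6 / 25) (1 / 10) (1 / 10) ha₁0 ha₂0 ha₃0 hρle (le_refl _) (le_refl _) (le_refl _) hr' hty₁.1.1 h2.1 h3.1
        hty₁.1.2 h2.2 h3.2 (by rw [hlamdef]; norm_num)
    · rw [htwo hw₂ hw₃ h23 hf₂ hf₃]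
      exact cand_arith_gen lam hlam0 hlam (7 / 10) 0 0 r' r₁ r₂ r₃ a₁ a₂ a₃ _ _ _ (12 / 25) (6 / 25) (6 / 25) (6 / 25)
        (6 / 25) (6 / 25) (6 / 25) ha₁0 ha₂0 ha₃0 (le_refl _) (le_refl _) (le_refl _) (le_refl _) hr' hty₁.1.1 hty₂.1.1
        hty₃.1.1 hty₁.1.2 hty₂.1.2 hty₃.1.2 (by rw [hlamdef]; norm_num)
    · -- only `w₂` fat
      have h1 := hty₁.2 (three_le_card_sdiff_clF_cand_of_not_fat hG hS hS6 hT hw₁ hf₁)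
      have h3 := hty₃.2 (three_le_card_sdiff_clF_cand_of_not_fat hG hS hS6 hT hw₃ hf₃)
      exact cand_arith_gen lam hlam0 hlam (7 / 10) (ρ₁ + ρ₂) (12 / 25) r' r₁ r₂ r₃ a₁ a₂ a₃ _ _ _ (12 / 25) (1 / 5) (6 / 25)
        (1 / 5) (1 / 10) (6 / 25) (1 / 10) ha₁0 ha₂0 ha₃0 hρle (le_refl _) (le_refl _) (le_refl _) hr' h1.1 hty₂.1.1 h3.1
        h1.2 hty₂.1.2 h3.2 (by rw [hlamdef]; norm_num)
    · -- only `w₃` fat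
      have h1 := hty₁.2 (three_le_card_sdiff_clF_cand_of_not_fat hG hS hS6 hT hw₁ hf₁)
      have h2 := hty₂.2 (three_le_card_sdiff_clF_cand_of_not_fat hG hS hS6 hT hw₂ hf₂)
      exact cand_arith_gen lam hlam0 hlam (7 / 10) (ρ₁ + ρ₂) (12 / 25) r' r₁ r₂ r₃ a₁ a₂ a₃ _ _ _ (12 / 25) (1 / 5) (1 / 5)
        (6 / 25) (1 / 10) (1 / 10) (6 / 25) ha₁0 ha₂0 ha₃0 hρle (le_refl _) (le_refl _) (le_refl _) hr' h1.1 h2.1 hty₃.1.1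
        h1.2 h2.2 hty₃.1.2 (by rw [hlamdef]; norm_num)
    · -- none fat
      have h1 := hty₁.2 (three_le_card_sdiff_clF_cand_of_not_fat hG hS hS6 hT hw₁ hf₁)
      have h2 := hty₂.2 (three_le_card_sdiff_clF_cand_of_not_fat hG hS hS6 hT hw₂ hf₂)
      have h3 := hty₃.2 (three_le_card_sdiff_clF_cand_of_not_fat hG hS hS6 hT hw₃ hf₃)
      exact cand_arith_gen lam hlam0 hlam (7 / 10) (ρ₁ + ρ₂) (12 / 25) r' r₁ r₂ r₃ a₁ a₂ a₃ _ _ _ (12 / 25) (1 / 5) (1 / 5)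
        (1 / 5) (1 / 10) (1 / 10) (1 / 10) ha₁0 ha₂0 ha₃0 hρle (le_refl _) (le_refl _) (le_refl _) hr' h1.1 h2.1 h3.1
        h1.2 h2.2 h3.2 (by rw [hlamdef]; norm_num)
  linarith

end ThreeOneC

end PercRepro.Shadow
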